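import Summits.CriticalPhenomena.PercolationContinuityZ3.Theorems.PercNearOneGluingNoHeavyLowerTailSahiSunflowerAllOrders
import Summits.CriticalPhenomena.PercolationContinuityZ3.Theorems.SahiConjecture
import Literature.Combinatorics.Sahi2008.Percolation
import Literature.Combinatorics.Sahi2008.PushForward
import Literature.Probability.LatticeModels.SahiFourthOrderCorrelation
import Mathlib.Tactic.FinCases
import Mathlib.Tactic.Linarith
import Mathlib.Tactic.Ring
import HarnessLib

/-!
# `NoHeavyLowerTail` (crux stmt-CriticalPhenomena-4575), master-family line P2 (Sahi's algebraic route): the FOUR-petal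
# sunflower algebra `M₄`, the closed form of its quartic `E₄`, and the four-point lower bound `4PT-LB` (statement first)

Support file (seat `prim-masterthm-p2`, gen 2; `--supports stmt-CriticalPhenomena-4575`); one `@[conjecture]` definition
(`FourPointLBRow`, an instance of Sahi's `C_4` for product measures, OPEN), no sorry.  Memo: SAHI-ROUTE.md §4.10.

THE SUNFLOWER TOWER.  For `m` terminals `A` of a finite weighted graph let `S_x = {A ∖ {x} lies in one open cluster}`
(`x ∈ A`).  Any two of these force all of `A` into one cluster, so `(S_x)` is an `m`-SUNFLOWER of increasing events with core
`K = {A connected}`; the complements `D_x = S_xᶜ` ("the other `m − 1` terminals are NOT all joined") are decreasing, and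
`E_m(D_x : x ∈ A) ≥ 0` is an instance of Sahi's `C_m` / the master family `(M-m)`.  `m = 3` is `3PT-LB = SHK3⁺`
(`D_x = {y ≁ z}`; THEOREM, `ThreePointLB.sahiE3_pairSep_nonneg`); `m = 4` is the new row `4PT-LB` typed here.  On the cell
poset `M_m = {K < C_1, …, C_m < O}` (masses `a; c_1..c_m; b`) Sahi's generating function [Sahi2008, Prop. 12] gives the
CLOSED FORM (memo §4.10, proved for all `m` on paper, symbolically checked `m ≤ 6`):
`E_m(D_1,…,D_m) = a(a+1)⋯(a+m−2)·b − Σ_{k=2}^{m} (a+k−1)(a+k)⋯(a+m−2)·e_k(c)`, i.e.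
`E_m ≥ 0 ⟺ ab ≥ e₂ + e₃/(a+1) + e₄/((a+1)(a+2)) + ⋯ + e_m/((a+1)⋯(a+m−2))`.

What is here (kernel-checked):
* the six-point poset `M4` (`core | pet (i : Fin 4) | out`), its up-sets `D i = {pet j (j ≠ i), out}`, and
  **`M4.sahiE_four_D`**: `E₄(χ_{D₀},…,χ_{D₃}) = (1+a)(2+a)(ab − e₂(c)) − (2+a)e₃(c) − e₄(c)` for every probability weight;
  `M4.sahiE_three_D`: the sub-sunflower cubic `E₃(χ_{D₀},χ_{D₁},χ_{D₂}) = (1+a)(a(b+c₃) − e₂(c₀,c₁,c₂)) − c₀c₁c₂`, and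
  **`M4.sahiE_three_D_nonneg_of_four`**: `E₄ ≥ 0 ⟹ E₃ ≥ 0` (downward heredity inside the tower, pure algebra);
* the pattern map `pat4 a b c d : BondConfig V → M4` and `pat4_quartic_eq`: the quartic of the pushed-forward percolation
  weight is `sahiE4 (prodBernoulli w) D_a D_b D_c D_d`, `D_x = (triConn of the other three)ᶜ`;
* **`FourPointLBRow`** (`@[conjecture]`, OPEN): `0 ≤ sahiE4 (prodBernoulli w) D_a D_b D_c D_d` on every finite weighted graph;
  `fourPointLBRow_of_sahiConjecture : SahiConjecture 4 → FourPointLBRow`; `fourPointLBRow_iff_cells`: the row in the closed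
  form `(1+t)(2+t)(t·r − e₂(u)) ≥ (2+t)e₃(u) + e₄(u)` of the six cell masses (`t` = all four joined, `u_x` = `x` cut off from
  the joined other three, `r` = no triple joined).
Census (this seat, exact enumeration, code/fourpt.py): 170 laws on K4, K5, K4 + 2 pendants, C4 + hub × {uniform, heterogeneous,
sparse, dense}: 0 negative, min `1.5e-6` (dense regime).  ttrl census requested (STATUS.md).  NUMERICAL CONJECTURE S₄ (memo):
on `M₄`, `SahiPositive 2 ∧ E₄(D) ≥ 0` implies `E_k ≥ 0` for ALL 96 antichain families (64 cubic, 25 quartic, 6 quintic, 1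
sextic): 0 / 8 153 random + 0 / 95 adversarial minimisations; i.e. conjecturally the single quartic row is the whole Sahi
hierarchy of the algebra, as the cubic is on `M₃` (`M3.sahiPositive_m3_iff`, a theorem).  Nothing open is used as a hypothesis
elsewhere except by name.
-/

namespace Summit.CriticalPhenomena.PercolationContinuityZ3.Theorems.SahiDeltaSystem

open Finset Function Literature.Combinatorics.Sahi2008

/-! ## Part 1.  The six-point poset `M₄` and the closed form of its quartic -/

/-- The poset `M₄`: core, four pairwise incomparable petals, top. [this work] -/
inductive M4 : Type
  | core : M4 | pet : Fin 4 → M4 | out : M4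
  deriving DecidableEq
namespace M4

/-- The order of `M₄` as a Boolean table. [this work] -/
def leb : M4 → M4 → Bool
  | core, _ => true
  | pet i, pet j => decide (i = j)
  | pet _, out => true
  | out, out => true
  | _, _ => false

/-- The order of `M₄`. [this work] -/
instance : LE M4 := ⟨fun x y => leb x y = true⟩

/-- The order of `M₄` is decidable. [this work] -/
instance decLE : DecidableRel (α := M4) (· ≤ ·) := fun x y => inferInstanceAs (Decidable (leb x y = true))

/-- The six points of `M₄`. [this work] -/
instance : Fintype M4 where
  elems := {core, pet 0, pet 1, pet 2, pet 3, out}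
  complete := by
    intro x
    rcases x with _ | i | _ <;> [simp; (fin_cases i <;> simp); simp]

/-- `M₄` is a partial order (kernel checks). [this work] -/
instance : PartialOrder M4 where
  le := (· ≤ ·)
  le_refl := by decide
  le_trans := by decide
  le_antisymm := by decide

/-- The sum over `M₄` written out. [this work] -/
theorem sum_eq (f : M4 → ℝ) : ∑ x, f x = f core + f (pet 0) + f (pet 1) + f (pet 2) + f (pet 3) + f out := by
  show Finset.sum {core, pet 0, pet 1, pet 2, pet 3, out} f = _
  rw [Finset.sum_insert (by decide), Finset.sum_insert (by decide), Finset.sum_insert (by decide),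
    Finset.sum_insert (by decide), Finset.sum_insert (by decide), Finset.sum_singleton]
  ring

/-- `D i = {pet j (j ≠ i), out}`: the complement of the `i`-th sunflower event. [this work] -/
def D (i : Fin 4) : Finset M4 := (Finset.univ.erase core).erase (pet i)

/-- The `D i` are up-sets of `M₄`. [this work] -/
theorem isUpperSet_D (i : Fin 4) : IsUpperSet ((D i : Finset M4) : Set M4) := by
  have h : ∀ (i : Fin 4) (x y : M4), x ≤ y → x ∈ D i → y ∈ D i := by decide
  intro x y hxy hx
  exact Finset.mem_coe.2 (h i x y hxy (Finset.mem_coe.1 hx))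

section Weight

variable (ν : M4 → ℝ)

/-- `E(f)` on `M₄`, cell by cell. [this work] -/
theorem ex_eq (f : M4 → ℝ) : ex ν f = ν core * f core + ν (pet 0) * f (pet 0) + ν (pet 1) * f (pet 1) +
    ν (pet 2) * f (pet 2) + ν (pet 3) * f (pet 3) + ν out * f out := by
  rw [ex_def, sum_eq]

/-- Total mass one, written out. [this work] -/
theorem sum_one_eq {ν : M4 → ℝ} (hν1 : ∑ x, ν x = 1) :
    ν core + ν (pet 0) + ν (pet 1) + ν (pet 2) + ν (pet 3) + ν out = 1 := by
  rw [← sum_eq]; exact hν1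

/-- **The quartic of the four-petal sunflower algebra, closed form**: with `a = ν core`, `b = ν out`, `c_i = ν (pet i)`,
`E₄(χ_{D₀},χ_{D₁},χ_{D₂},χ_{D₃}) = (1+a)(2+a)(ab − e₂(c)) − (2+a)e₃(c) − e₄(c)`. [this work] -/
theorem sahiE_four_D {ν : M4 → ℝ} (hν1 : ∑ x, ν x = 1) :
    sahiE ν 4 ![setInd (D 0), setInd (D 1), setInd (D 2), setInd (D 3)] =
      (1 + ν core) * (2 + ν core) * (ν core * ν out -
          (ν (pet 0) * ν (pet 1) + ν (pet 0) * ν (pet 2) + ν (pet 0) * ν (pet 3) + ν (pet 1) * ν (pet 2) +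
            ν (pet 1) * ν (pet 3) + ν (pet 2) * ν (pet 3))) -
        (2 + ν core) * (ν (pet 0) * ν (pet 1) * ν (pet 2) + ν (pet 0) * ν (pet 1) * ν (pet 3) +
          ν (pet 0) * ν (pet 2) * ν (pet 3) + ν (pet 1) * ν (pet 2) * ν (pet 3)) -
        ν (pet 0) * ν (pet 1) * ν (pet 2) * ν (pet 3) := by
  have hs := sum_one_eq hν1
  have hb : ν out = 1 - ν core - ν (pet 0) - ν (pet 1) - ν (pet 2) - ν (pet 3) := by linarith
  rw [sahiE_four]
  simp [ex_eq, setInd_apply, D]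
  rw [hb]; ring

/-- **The sub-sunflower cubic on `M₄`** (petal `3` merged into the top):
`E₃(χ_{D₀},χ_{D₁},χ_{D₂}) = (1+a)(a(b+c₃) − e₂(c₀,c₁,c₂)) − c₀c₁c₂`. [this work] -/
theorem sahiE_three_D {ν : M4 → ℝ} (hν1 : ∑ x, ν x = 1) :
    sahiE ν 3 ![setInd (D 0), setInd (D 1), setInd (D 2)] =
      (1 + ν core) * (ν core * (ν out + ν (pet 3)) -
          (ν (pet 0) * ν (pet 1) + ν (pet 0) * ν (pet 2) + ν (pet 1) * ν (pet 2))) -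
        ν (pet 0) * ν (pet 1) * ν (pet 2) := by
  have hs := sum_one_eq hν1
  have hb : ν out = 1 - ν core - ν (pet 0) - ν (pet 1) - ν (pet 2) - ν (pet 3) := by linarith
  rw [sahiE_three]
  simp [ex_eq, setInd_apply, D]
  rw [hb]; ring

/-- **Downward heredity inside the sunflower tower** (pure algebra): on `M₄`, `E₄(D₀,D₁,D₂,D₃) ≥ 0` implies the
sub-sunflower cubic `E₃(D₀,D₁,D₂) ≥ 0` — since `ab ≥ e₂ + e₃/(1+a) + e₄/((1+a)(2+a))` gives
`a(b + c₃) ≥ e₂(c₀,c₁,c₂) + c₀c₁c₂/(1+a)`. [this work] -/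
theorem sahiE_three_D_nonneg_of_four {ν : M4 → ℝ} (hν0 : ∀ x, 0 ≤ ν x) (hν1 : ∑ x, ν x = 1)
    (h4 : 0 ≤ sahiE ν 4 ![setInd (D 0), setInd (D 1), setInd (D 2), setInd (D 3)]) :
    0 ≤ sahiE ν 3 ![setInd (D 0), setInd (D 1), setInd (D 2)] := by
  rw [sahiE_four_D hν1] at h4
  rw [sahiE_three_D hν1]
  have ha := hν0 core; have h0 := hν0 (pet 0); have h1 := hν0 (pet 1); have h2 := hν0 (pet 2); have h3 := hν0 (pet 3)
  -- (2+a)·E₃ = E₄ + (nonnegative terms)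
  have key : (2 + ν core) * ((1 + ν core) * (ν core * (ν out + ν (pet 3)) -
      (ν (pet 0) * ν (pet 1) + ν (pet 0) * ν (pet 2) + ν (pet 1) * ν (pet 2))) - ν (pet 0) * ν (pet 1) * ν (pet 2)) =
      ((1 + ν core) * (2 + ν core) * (ν core * ν out -
          (ν (pet 0) * ν (pet 1) + ν (pet 0) * ν (pet 2) + ν (pet 0) * ν (pet 3) + ν (pet 1) * ν (pet 2) +
            ν (pet 1) * ν (pet 3) + ν (pet 2) * ν (pet 3))) -
        (2 + ν core) * (ν (pet 0) * ν (pet 1) * ν (pet 2) + ν (pet 0) * ν (pet 1) * ν (pet 3) +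
          ν (pet 0) * ν (pet 2) * ν (pet 3) + ν (pet 1) * ν (pet 2) * ν (pet 3)) -
        ν (pet 0) * ν (pet 1) * ν (pet 2) * ν (pet 3)) +
      ν (pet 3) * ((1 + ν core) * (2 + ν core) * (ν core + ν (pet 0) + ν (pet 1) + ν (pet 2)) +
        (2 + ν core) * (ν (pet 0) * ν (pet 1) + ν (pet 0) * ν (pet 2) + ν (pet 1) * ν (pet 2)) +
        ν (pet 0) * ν (pet 1) * ν (pet 2)) := by ring
  have hpos : 0 ≤ ν (pet 3) * ((1 + ν core) * (2 + ν core) * (ν core + ν (pet 0) + ν (pet 1) + ν (pet 2)) +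
        (2 + ν core) * (ν (pet 0) * ν (pet 1) + ν (pet 0) * ν (pet 2) + ν (pet 1) * ν (pet 2)) +
        ν (pet 0) * ν (pet 1) * ν (pet 2)) := by positivity
  have h2a : 0 < 2 + ν core := by linarith
  nlinarith [key, hpos, h2a, h4]

end Weight
end M4

/-! ## Part 2.  The four-point pattern map and the row `4PT-LB` -/

section FourPoint

open MeasureTheory
open Literature.Probability.LatticeModels (prodBernoulli sahiE4)
open Literature.Probability.Percolation
open Literature.Probability.Percolation.DecisionTree (ind ind_of_mem ind_of_not_mem ind_nonneg)
open M4

variable {V : Type*} [Fintype V]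

/-- `triConn x y z`: the three vertices lie in one open cluster (`x ↔ y` and `y ↔ z`; increasing). [this work] -/
def triConn (x y z : V) : Set (BondConfig V) := openConn x y ∩ openConn y z

/-- The four-point pattern map: `core` if `a b c d` are all joined, `pet x` if exactly the three terminals other than `x` are
mutually joined, `out` if no three of them are. [this work] -/
noncomputable def pat4 (a b c d : V) (ω : BondConfig V) : M4 := by
  classical
  exact if ω ∈ triConn b c d ∧ ω ∈ triConn a c d then core
    else if ω ∈ triConn b c d then pet 0 else if ω ∈ triConn a c d then pet 1
    else if ω ∈ triConn a b d then pet 2 else if ω ∈ triConn a b c then pet 3 else out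

omit [Fintype V] in
/-- The up-sets `D i` pull back along `pat4` to the complements of the four triple-connection events (uses only: two distinct
connected triples force all four terminals into one cluster). [this work] -/
theorem setInd_D_comp_pat4 (a b c d : V) :
    (setInd (D 0) ∘ pat4 a b c d = ind (triConn b c d)ᶜ) ∧ (setInd (D 1) ∘ pat4 a b c d = ind (triConn a c d)ᶜ) ∧
      (setInd (D 2) ∘ pat4 a b c d = ind (triConn a b d)ᶜ) ∧ (setInd (D 3) ∘ pat4 a b c d = ind (triConn a b c)ᶜ) := by
  have R : ∀ {ω : BondConfig V} {x y : V}, ω ∈ openConn x y → (openGraph ω).Reachable x y := fun h => h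
  have M : ∀ {ω : BondConfig V} {x y : V}, (openGraph ω).Reachable x y → ω ∈ openConn x y := fun h => h
  refine ⟨?_, ?_, ?_, ?_⟩ <;> funext ω <;>
    simp only [Function.comp, setInd_apply, D, Finset.mem_erase, Finset.mem_univ, pat4, ind, Set.mem_compl_iff, triConn,
      Set.mem_inter_iff] <;>
    by_cases h1 : ω ∈ openConn b c <;> by_cases h2 : ω ∈ openConn c d <;> by_cases h3 : ω ∈ openConn a c <;>
    by_cases h4 : ω ∈ openConn a b <;> by_cases h5 : ω ∈ openConn b d <;>
    simp (config := { decide := true }) [h1, h2, h3, h4, h5] <;>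
    first
    | exact absurd (M ((R h1).symm.trans (R h5))) h2
    | exact absurd (M ((R h1).trans (R h2))) h5
    | exact absurd (M ((R h3).trans (R h1).symm)) h4
    | exact absurd (M ((R h4).symm.trans (R h3))) h1
    | exact absurd (M ((R h4).trans (R h1))) h3

/-- **The quartic of the four-point pattern weight is `E₄` of the four triple-disconnection events.** [this work] -/
theorem pat4_quartic_eq (w : Sym2 V → unitInterval) (a b c d : V) :
    sahiE (pushWeight (bernoulliWeight w) (pat4 a b c d)) 4 ![setInd (D 0), setInd (D 1), setInd (D 2), setInd (D 3)] =
      sahiE4 (prodBernoulli w) (triConn b c d)ᶜ (triConn a c d)ᶜ (triConn a b d)ᶜ (triConn a b c)ᶜ := by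
  rw [sahiE_pushWeight]
  obtain ⟨h0, h1, h2, h3⟩ := setInd_D_comp_pat4 (V := V) a b c d
  have e : (fun i => (![setInd (D 0), setInd (D 1), setInd (D 2), setInd (D 3)] : Fin 4 → M4 → ℝ) i ∘ pat4 a b c d) =
      ![ind (triConn b c d)ᶜ, ind (triConn a c d)ᶜ, ind (triConn a b d)ᶜ, ind (triConn a b c)ᶜ] := by
    funext i
    fin_cases i
    · exact h0
    · exact h1
    · exact h2
    · exact h3
  rw [e, sahiE_four_ind]

/-- **`4PT-LB` in the six cells.**  For every finite weighted graph and `a b c d`, with `ν` the pattern weight (`t = ν core` =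
all four joined, `u_i = ν (pet i)` = terminal `i` cut off from the mutually joined other three, `r = ν out` = no triple joined):
`E₄(D_a,D_b,D_c,D_d) = (1+t)(2+t)(t r − e₂(u)) − (2+t)e₃(u) − e₄(u)`. [this work] -/
theorem sahiE4_fourPoint_eq (w : Sym2 V → unitInterval) (a b c d : V) :
    sahiE4 (prodBernoulli w) (triConn b c d)ᶜ (triConn a c d)ᶜ (triConn a b d)ᶜ (triConn a b c)ᶜ =
      let ν := pushWeight (bernoulliWeight w) (pat4 a b c d)
      (1 + ν core) * (2 + ν core) * (ν core * ν out -
          (ν (pet 0) * ν (pet 1) + ν (pet 0) * ν (pet 2) + ν (pet 0) * ν (pet 3) + ν (pet 1) * ν (pet 2) +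
            ν (pet 1) * ν (pet 3) + ν (pet 2) * ν (pet 3))) -
        (2 + ν core) * (ν (pet 0) * ν (pet 1) * ν (pet 2) + ν (pet 0) * ν (pet 1) * ν (pet 3) +
          ν (pet 0) * ν (pet 2) * ν (pet 3) + ν (pet 1) * ν (pet 2) * ν (pet 3)) -
        ν (pet 0) * ν (pet 1) * ν (pet 2) * ν (pet 3) := by
  rw [← pat4_quartic_eq, sahiE_four_D]
  rw [sum_pushWeight, sum_bernoulliWeight]

end FourPoint

/-! ## Part 3.  The row `4PT-LB` (statement first) -/

section Row

open MeasureTheory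
open Literature.Probability.LatticeModels (prodBernoulli sahiE4)
open Literature.Probability.Percolation
open Literature.Probability.Percolation.DecisionTree (ind ind_of_mem ind_of_not_mem ind_nonneg)

/-- **Bridge, decreasing events, order 4**: if the dual product weight is Sahi-positive of order `4`, then
`0 ≤ sahiE4 (prodBernoulli p) A B C D` for any four decreasing events (order reversal, as `sahiE3_nonneg_of_sahiPositive_lower`).
[this work] -/
theorem sahiE4_nonneg_of_sahiPositive_lower {ι : Type*} [Fintype ι] (p : ι → unitInterval)
    (h : SahiPositive (bernoulliWeightDual p) 4) {A B C D : Set (Set ι)}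
    (hA : IsLowerSet A) (hB : IsLowerSet B) (hC : IsLowerSet C) (hD : IsLowerSet D) :
    0 ≤ sahiE4 (prodBernoulli p) A B C D := by
  rw [← sahiE_four_ind]
  have key := h ![fun x => ind A (OrderDual.ofDual x), fun x => ind B (OrderDual.ofDual x),
      fun x => ind C (OrderDual.ofDual x), fun x => ind D (OrderDual.ofDual x)] (fun i x => ?_) (fun i => ?_)
  · exact key
  · fin_cases i <;> exact ind_nonneg _ _
  · fin_cases i
    · exact monotone_ind_toDual_of_isLowerSet hA
    · exact monotone_ind_toDual_of_isLowerSet hB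
    · exact monotone_ind_toDual_of_isLowerSet hC
    · exact monotone_ind_toDual_of_isLowerSet hD

/-- **4PT-LB — the four-point lower bound** (the `m = 4` member of the sunflower tower whose `m = 3` member is
`3PT-LB = SHK3⁺`).  For every finite weighted graph and vertices `a b c d`:
`0 ≤ E₄(D_a, D_b, D_c, D_d)`, `D_x = {the three terminals other than x are NOT all in one open cluster}`; in the six cells
`(1+t)(2+t)(t·r − e₂(u)) ≥ (2+t)e₃(u) + e₄(u)` (`sahiE4_fourPoint_eq`).  Instance of Sahi's `C_4` for product measures
(`fourPointLBRow_of_sahiConjecture`); OPEN — census (this seat, exact): 170 laws on K4 / K5 / K4+pendants / C4+hub, 0 negative;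
ttrl census requested.  [cite: Sahi2008, Conj. 5 (p. 212); LiebSahi2021, Conj. 1.1] [status: open] -/
@[conjecture] def FourPointLBRow : Prop :=
  ∀ (V : Type) [Fintype V] (w : Sym2 V → unitInterval) (a b c d : V),
    0 ≤ sahiE4 (prodBernoulli w) (triConn b c d)ᶜ (triConn a c d)ᶜ (triConn a b d)ᶜ (triConn a b c)ᶜ

/-- The triple-disconnection events are decreasing. [this work] -/
theorem isLowerSet_compl_triConn {V : Type*} (x y z : V) : IsLowerSet (triConn x y z : Set (BondConfig V))ᶜ :=
  ((isUpperSet_openConn x y).inter (isUpperSet_openConn y z)).compl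

/-- **Sahi's `C_4` ⇒ `4PT-LB`.** [this work] -/
theorem fourPointLBRow_of_sahiConjecture (hC : SahiConjecture 4) : FourPointLBRow := by
  intro V _ w a b c d
  exact sahiE4_nonneg_of_sahiPositive_lower w
    (hC (Set (Sym2 V))ᵒᵈ (bernoulliWeightDual w) (isFKGMeasure_bernoulliWeightDual w))
    (isLowerSet_compl_triConn b c d) (isLowerSet_compl_triConn a c d) (isLowerSet_compl_triConn a b d)
    (isLowerSet_compl_triConn a b c)

/-- **`4PT-LB` ⇒ the sub-sunflower cubic** `E₃(D_a, D_b, D_c) ≥ 0` of the same four-point algebra (downward heredity,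
`M4.sahiE_three_D_nonneg_of_four`; this cubic is NOT `3PT-LB(a,b,c)` — its events still refer to `d`). [this work] -/
theorem sahiE_three_fourPoint_nonneg_of_row (h : FourPointLBRow) (V : Type) [Fintype V] (w : Sym2 V → unitInterval)
    (a b c d : V) :
    0 ≤ sahiE (pushWeight (bernoulliWeight w) (pat4 a b c d)) 3 ![setInd (M4.D 0), setInd (M4.D 1), setInd (M4.D 2)] := by
  have hν0 : ∀ x, 0 ≤ pushWeight (bernoulliWeight w) (pat4 a b c d) x :=
    fun x => pushWeight_nonneg (isFKGMeasure_bernoulliWeight w).nonneg _ x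
  have hν1 : ∑ x, pushWeight (bernoulliWeight w) (pat4 a b c d) x = 1 := by rw [sum_pushWeight, sum_bernoulliWeight]
  refine M4.sahiE_three_D_nonneg_of_four hν0 hν1 ?_
  rw [pat4_quartic_eq]
  exact h V w a b c d

end Row

end Summit.CriticalPhenomena.PercolationContinuityZ3.Theorems.SahiDeltaSystem
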